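import Literature.Barriers.CriticalPhenomena.LaceExpansionXSpaceLemma16
import Literature.Probability.Percolation.InfraredBoundTriangle
import HarnessLib

/-!
# The diagrammatic estimate `Σ_x Π^{(N)}-diagram ≤ Δ_{p_c} (2 Δ̃_{p_c} Δ_{p_c})^N` for the
# Hara–Slade diagrams at `p_c` (Heydenreich–van der Hofstad 2017, Prop. 7.4, (7.5.3)) and the
# reversed recursion `Ψ̄` (Exercise 7.5) — PROVED

Barrier catalogue `Literature/Barriers/CriticalPhenomena/` (D-0021), companion of
`LaceExpansionXSpaceLemma16.lean`, which reduced Hara's Lemma 1.6 (percolation, `Hara2008_lemma16Pc`)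
to the two named facts `HvdH2017_piNDiagramBoundPc` (the Hara–Slade coefficients at `p_c` lie
below the explicit diagrams `piNDiagramPc d N` of Heydenreich–van der Hofstad (7.2.9), (7.4.10),
jointly summable in `(N, x)`) and `Hara2008_weightedNLoopBoundPc` (Hara's weighted `N`-loop
estimate for those diagrams). Both rest, in print, on the recursive estimate of
Heydenreich–van der Hofstad §7.5.1 for the recursion `Ψ^{(N)}` ((7.5.5)–(7.5.6), `percPsi`):
the sum over `x` of the `N`-th diagram is at most `Σ_{w,u} Ψ^{(N)}(w, u)` ((7.5.7)–(7.5.8)), and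
`Σ_{w,u} Ψ^{(N)}(w, u) ≤ Δ_p (2Δ̃_pΔ_p)^N` ((7.5.9)) by induction, the step being the bound
`max_{w,u} Σ_{z,t,w',u'} B₁(w,u,z,t) B₂(z,t,w',u') ≤ 2Δ̃_pΔ_p` ((7.5.12)) computed in
(7.5.13)–(7.5.14) from the two terms of `B₂` "making use of translation invariance". The
weighted estimates of §7.5.2 (and Hara's §3.4) close the diagrams from the right with the
reversed recursion `Ψ̄^{(i)}(x,y) = Σ B₂(x,y,s,t) B₁(s,t,u,v) Ψ̄^{(i-1)}(u,v)` ((7.5.20)), which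
"also obeys (7.5.9)" (Exercise 7.5). This file PROVES all of this for the explicit lattice sums
at `p = p_c`, in `[0, ∞]` and with no hypothesis on `d` (they are identities and monotonicity
statements about non-negative sums over `ℤ^d`):

* the critical two-point function as a function of the displacement, `tauPcE d v = τ_{p_c}(0,v)`,
  `tauTildePcE d v = τ̃(0,v)` (evenness and translation invariance from `tau_add_right`,
  `tau_comm`, `tau_zero_neg`), and the diagrams `percA3`, `percB1`, `percB2 = percB2one + percB2two` in that
  form ((7.4.2)–(7.4.4));
* DEFINITIONS `percTri d x = Δ_{p_c}(x)`, `percTriBar d = Δ_{p_c}` ((7.2.1), as the supremum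
  over `x`), `percTriTilde d x = Δ̃_{p_c}(x)`, `percTriTildeBar d = Δ̃_{p_c}` ((7.2.2)–(7.2.4)),
  the open bubble `percBubble` (`τ ⋆ τ`), the kernel sums `percB1B2Sum`, `percB1B2Norm`
  ((7.5.11)–(7.5.12)), the reversed recursion `percPsiBar` ((7.5.20)) with its kernel sums
  `percB2B1Sum`, `percB2B1Norm`;
* PROVED: (7.5.10) `tsum_percPsi_zero` (`Σ Ψ^{(0)} = Δ_{p_c}(0)`), (7.5.7)
  `tsum_percA3_le_tsum_percB2`, (7.5.8) `tsum_piNDiagramPc_succ_le_tsum_percPsi`, (7.5.11)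
  `tsum_percPsi_succ_le`, (7.5.13) `tsum_percB1_mul_percB2one_le`, (7.5.14)
  `tsum_percB1_mul_percB2two_le`, (7.5.12) `percB1B2Norm_le`, (7.5.9) `tsum_percPsi_le`,
  Prop. 7.4 (7.5.3) `HvdH2017_prop74_piNDiagramPc_le`
  (`Σ_x piNDiagramPc d N x ≤ Δ_{p_c} (2Δ̃_{p_c}Δ_{p_c})^N`, `N ≥ 1`), the geometric sum over
  `N ≥ 1` (`tsum_tsum_piNDiagramPc_succ_le`, `_lt_top`: finite as soon as `Δ_{p_c} < ∞` and
  `2Δ̃_{p_c}Δ_{p_c} < 1`), and Exercise 7.5 `tsum_percPsiBar_le` (with the reversed kernel bound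
  `percB2B1Norm_le`, the analogues of (7.5.13)–(7.5.14)).

Design. `Δ_p` is printed as `max_x Δ_p(x) = Δ_p(0)` ((7.2.1), "the last equality is established in
Exerc. 5.2", i.e. by `τ̂_p ≥ 0`); only the maximum is used in §7.5, so `percTriBar` is the
supremum and the identification with `Δ_{p_c}(0)` is not needed here. The generic tools are
`tsum_series3` / `tsum_series2` (lines in series between fixed endpoints are a function of the
difference of the endpoints), `tsum_shift`, `tsum_reflect_shift` (the substitutions
`a' = a - z`, `u' = u'' + z` of (7.5.14)) and `tsum_quad_eq_tsum_pair_pair` (a sum over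
`(ℤ^d)⁴` as an iterated sum over two pairs). Not here: the `k`-dependent bound (7.5.4) and its
diagrams `W_p(k)`, `H_p(k)` (§7.5.2), whose two-weight, `x`-space analogue is Hara's §3.4.

## References

* M. Heydenreich, R. van der Hofstad, *Progress in High-Dimensional Percolation and Random
  Graphs*, Springer 2017: (7.2.1)–(7.2.4) (`Δ_p(x)`, `Δ_p`, `Δ̃_p(x)`, `τ̃_p`, `Δ̃_p`); (7.4.2)–(7.4.4)
  (`A₃`, `B₁`, `B₂ = B₂⁽¹⁾ + B₂⁽²⁾`), (7.4.10); Prop. 7.4 ((7.5.3): "`Σ_x Π^{(N)}(x) ≤ Δ_p(2Δ̃_pΔ_p)^N`",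
  `N ≥ 1`); §7.5.1: (7.5.5)–(7.5.6) (`Ψ^{(N)}`), (7.5.7)–(7.5.8), the induction hypothesis (7.5.9),
  (7.5.10), (7.5.11), (7.5.12) and its proof (7.5.13)–(7.5.14) ("where `a' = a - z_N`,
  `u'_N = u_N - z_N`"); §7.5.2: (7.5.20) (`Ψ̄^{(i)}`) and Exercise 7.5 ("Prove that `Ψ̄^{(N)}` also
  obeys (7.5.9)"); the remark after Prop. 7.4 ("we need that `2Δ̃_pΔ_p < 1` in order for the
  geometric sum (over `N`) to converge").
* T. Hara, Ann. Probab. 36 (2008) 530–593 (arXiv:math-ph/0504021): §3.4 (the `N`-loop diagrams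
  these sums weigh).
-/

noncomputable section

namespace Literature.Barriers.CriticalPhenomena

open _root_.MeasureTheory _root_.Filter Literature.Probability.LatticeModels
  Literature.Probability.Percolation

open scoped ENNReal

variable {d : ℕ}

/-! ### The critical two-point function as a function of the displacement, in `[0, ∞]` -/

/-- `τ(v) := τ_{p_c}(0, v) ∈ [0, ∞]`, the critical two-point function as a function of the
displacement. [cite: HeydenreichVanDerHofstad2017, (7.2.1)] -/
def tauPcE (d : ℕ) (v : Site d) : ℝ≥0∞ := ENNReal.ofReal (tau d (criticalProbI d) 0 v)

/-- `τ_{p_c}(x, y) = τ(y - x)`. [folklore] -/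
theorem ofReal_tau_eq (x y : Site d) :
    ENNReal.ofReal (tau d (criticalProbI d) x y) = tauPcE d (y - x) := by
  rw [tauPcE, ← tau_eq_tau_zero_sub]

/-- `τ(-v) = τ(v)`. [folklore] -/
theorem tauPcE_neg (v : Site d) : tauPcE d (-v) = tauPcE d v := by
  rw [tauPcE, tauPcE, tau_zero_neg]

/-- `τ(x - y) = τ(y - x)`. [folklore] -/
theorem tauPcE_sub_comm (x y : Site d) : tauPcE d (x - y) = tauPcE d (y - x) := by
  rw [← neg_sub, tauPcE_neg]

/-- `τ(0) = 1`. [folklore] -/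
@[simp] theorem tauPcE_zero : tauPcE d 0 = 1 := by
  simp [tauPcE]

/-- `τ̃(x, y) = τ̃(0, y - x)` (translation invariance). [folklore] -/
theorem tauTildePc_eq_zero_sub (x y : Site d) : tauTildePc d x y = tauTildePc d 0 (y - x) := by
  unfold tauTildePc
  congr 1
  refine Finset.sum_congr rfl fun i _ => ?_
  rw [tau_eq_tau_zero_sub _ (x + _) y, tau_eq_tau_zero_sub _ (x - _) y,
    tau_eq_tau_zero_sub _ ((0 : Site d) + _) (y - x),
    tau_eq_tau_zero_sub _ ((0 : Site d) - _) (y - x)]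
  have h1 : y - (x + Pi.single i 1) = y - x - ((0 : Site d) + Pi.single i 1) := by abel
  have h2 : y - (x - Pi.single i 1) = y - x - ((0 : Site d) - Pi.single i 1) := by abel
  rw [h1, h2]

/-- `τ̃(0, -v) = τ̃(0, v)`. [folklore] -/
theorem tauTildePc_zero_neg (v : Site d) : tauTildePc d 0 (-v) = tauTildePc d 0 v := by
  unfold tauTildePc
  congr 1
  refine Finset.sum_congr rfl fun i _ => ?_
  rw [tau_eq_tau_zero_sub _ ((0 : Site d) + _) (-v), tau_eq_tau_zero_sub _ ((0 : Site d) - _) (-v),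
    tau_eq_tau_zero_sub _ ((0 : Site d) + _) v, tau_eq_tau_zero_sub _ ((0 : Site d) - _) v]
  have h1 : -v - ((0 : Site d) + Pi.single i 1) = -(v - (0 - Pi.single i 1)) := by abel
  have h2 : -v - ((0 : Site d) - Pi.single i 1) = -(v - (0 + Pi.single i 1)) := by abel
  rw [h1, tau_zero_neg, h2, tau_zero_neg, add_comm]

/-- `τ̃(v) := τ̃(0, v) = 2dp_c (D ⋆ τ_{p_c})(v) ∈ [0, ∞]`. [cite: HeydenreichVanDerHofstad2017, (7.2.3)] -/
def tauTildePcE (d : ℕ) (v : Site d) : ℝ≥0∞ := ENNReal.ofReal (tauTildePc d 0 v)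

/-- `τ̃(x, y) = τ̃(y - x)`. [folklore] -/
theorem ofReal_tauTildePc_eq (x y : Site d) :
    ENNReal.ofReal (tauTildePc d x y) = tauTildePcE d (y - x) := by
  rw [tauTildePcE, ← tauTildePc_eq_zero_sub]

/-- `τ̃(-v) = τ̃(v)`. [folklore] -/
theorem tauTildePcE_neg (v : Site d) : tauTildePcE d (-v) = tauTildePcE d v := by
  rw [tauTildePcE, tauTildePcE, tauTildePc_zero_neg]

/-- `τ̃(x - y) = τ̃(y - x)`. [folklore] -/
theorem tauTildePcE_sub_comm (x y : Site d) : tauTildePcE d (x - y) = tauTildePcE d (y - x) := by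
  rw [← neg_sub, tauTildePcE_neg]

/-! ### The simple diagrams in displacement form -/

/-- `A₃(s, u, v) = τ(v - s) τ(u - s) τ(v - u)`. [cite: HeydenreichVanDerHofstad2017, (7.4.2)] -/
theorem percA3_eq (s u v : Site d) :
    percA3 d s u v = tauPcE d (v - s) * tauPcE d (u - s) * tauPcE d (v - u) := by
  rw [percA3, ENNReal.ofReal_mul (mul_nonneg (tau_nonneg _ _ _) (tau_nonneg _ _ _)),
    ENNReal.ofReal_mul (tau_nonneg _ _ _), ofReal_tau_eq, ofReal_tau_eq, ofReal_tau_eq]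

/-- `B₁(s, t, u, v) = τ̃(v - t) τ(u - s)`. [cite: HeydenreichVanDerHofstad2017, (7.4.3)] -/
theorem percB1_eq (s t u v : Site d) :
    percB1 d s t u v = tauTildePcE d (v - t) * tauPcE d (u - s) := by
  rw [percB1, ENNReal.ofReal_mul (tauTildePc_nonneg _ _), ofReal_tauTildePc_eq, ofReal_tau_eq]

/-- The first term `B₂⁽¹⁾(u, v, s, t) = τ(v - u) τ(t - u) τ(s - v) τ(t - s)` of `B₂`.
[cite: HeydenreichVanDerHofstad2017, (7.4.4)] -/
def percB2one (d : ℕ) (u v s t : Site d) : ℝ≥0∞ :=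
  tauPcE d (v - u) * tauPcE d (t - u) * tauPcE d (s - v) * tauPcE d (t - s)

/-- The second term `B₂⁽²⁾(u, v, s, t) = δ_{v,s} Σ_a τ(a - s) τ(u - a) τ(t - a) τ(t - u)` of `B₂`.
[cite: HeydenreichVanDerHofstad2017, (7.4.4)] -/
def percB2two (d : ℕ) (u v s t : Site d) : ℝ≥0∞ :=
  if v = s then ∑' a : Site d, tauPcE d (a - s) * tauPcE d (u - a) * tauPcE d (t - a) * tauPcE d (t - u)
  else 0

/-- `B₂ = B₂⁽¹⁾ + B₂⁽²⁾`. [cite: HeydenreichVanDerHofstad2017, (7.4.4)] -/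
theorem percB2_eq (u v s t : Site d) : percB2 d u v s t = percB2one d u v s t + percB2two d u v s t := by
  rw [percB2, percB2one, percB2two]
  congr 1
  · rw [ENNReal.ofReal_mul (mul_nonneg (mul_nonneg (tau_nonneg _ _ _) (tau_nonneg _ _ _))
      (tau_nonneg _ _ _)), ENNReal.ofReal_mul (mul_nonneg (tau_nonneg _ _ _) (tau_nonneg _ _ _)),
      ENNReal.ofReal_mul (tau_nonneg _ _ _), ofReal_tau_eq, ofReal_tau_eq, ofReal_tau_eq,
      ofReal_tau_eq]
  · split_ifs
    · refine tsum_congr fun a => ?_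
      rw [ENNReal.ofReal_mul (mul_nonneg (mul_nonneg (tau_nonneg _ _ _) (tau_nonneg _ _ _))
        (tau_nonneg _ _ _)), ENNReal.ofReal_mul (mul_nonneg (tau_nonneg _ _ _) (tau_nonneg _ _ _)),
        ENNReal.ofReal_mul (tau_nonneg _ _ _), ofReal_tau_eq, ofReal_tau_eq, ofReal_tau_eq,
        ofReal_tau_eq]
    · rfl

/-! ### The triangle diagrams `Δ_{p_c}` and `Δ̃_{p_c}` -/

/-- The **triangle function** `Δ_{p_c}(x) := Σ_{y,z} τ(y) τ(z - y) τ(x - z)` at `p = p_c`, in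
`[0, ∞]` (indexed by `(y, z) ∈ ℤ^d × ℤ^d`). [cite: HeydenreichVanDerHofstad2017, (7.2.1)] -/
def percTri (d : ℕ) (x : Site d) : ℝ≥0∞ :=
  ∑' yz : Site d × Site d, tauPcE d yz.1 * tauPcE d (yz.2 - yz.1) * tauPcE d (x - yz.2)

/-- The **triangle diagram** `Δ_{p_c} := max_x Δ_{p_c}(x)` (here the supremum, in `[0, ∞]`).
[cite: HeydenreichVanDerHofstad2017, (7.2.1)] -/
def percTriBar (d : ℕ) : ℝ≥0∞ := ⨆ x : Site d, percTri d x

/-- `Δ̃_{p_c}(x) := Σ_{y,z} τ(y) τ(z - y) τ̃(x - z) = (τ ⋆ τ ⋆ τ̃)(x)` at `p = p_c`, in `[0, ∞]`.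
[cite: HeydenreichVanDerHofstad2017, (7.2.2)] -/
def percTriTilde (d : ℕ) (x : Site d) : ℝ≥0∞ :=
  ∑' yz : Site d × Site d, tauPcE d yz.1 * tauPcE d (yz.2 - yz.1) * tauTildePcE d (x - yz.2)

/-- `Δ̃_{p_c} := max_x Δ̃_{p_c}(x)` (the supremum, in `[0, ∞]`).
[cite: HeydenreichVanDerHofstad2017, (7.2.4)] -/
def percTriTildeBar (d : ℕ) : ℝ≥0∞ := ⨆ x : Site d, percTriTilde d x

/-- **Three lines in series between fixed endpoints**: `Σ_{y,z} f(y - a) g(z - y) h(b - z)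
= Σ_{y,z} f(y) g(z - y) h((b - a) - z)` (translation by `a`). [folklore] -/
theorem tsum_series3 (f g h : Site d → ℝ≥0∞) (a b : Site d) :
    ∑' yz : Site d × Site d, f (yz.1 - a) * g (yz.2 - yz.1) * h (b - yz.2) =
      ∑' yz : Site d × Site d, f yz.1 * g (yz.2 - yz.1) * h (b - a - yz.2) := by
  rw [← Equiv.tsum_eq ((Equiv.addRight a).prodCongr (Equiv.addRight a))]
  refine tsum_congr fun yz => ?_
  simp only [Equiv.prodCongr_apply, Equiv.coe_addRight, Prod.map_fst, Prod.map_snd]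
  rw [add_sub_cancel_right, add_sub_add_right_eq_sub, show b - (yz.2 + a) = b - a - yz.2 by abel]

/-- `Σ_{y,z} τ(y - a) τ(z - y) τ(b - z) = Δ_{p_c}(b - a)`. [cite: HeydenreichVanDerHofstad2017, (7.2.1)] -/
theorem tsum_tau3_eq_percTri (a b : Site d) :
    ∑' yz : Site d × Site d, tauPcE d (yz.1 - a) * tauPcE d (yz.2 - yz.1) * tauPcE d (b - yz.2) =
      percTri d (b - a) :=
  tsum_series3 _ _ _ a b

/-- `Σ_{y,z} τ(y - a) τ(z - y) τ̃(b - z) = Δ̃_{p_c}(b - a)`. [cite: HeydenreichVanDerHofstad2017, (7.2.2)] -/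
theorem tsum_tau2tilde_eq_percTriTilde (a b : Site d) :
    ∑' yz : Site d × Site d, tauPcE d (yz.1 - a) * tauPcE d (yz.2 - yz.1) * tauTildePcE d (b - yz.2) =
      percTriTilde d (b - a) :=
  tsum_series3 _ _ _ a b

/-- A sum over `ℤ^d × ℤ^d × ℤ^d × ℤ^d` as an iterated sum over two pairs. [folklore] -/
theorem tsum_quad_eq_tsum_pair_pair (F : Site d × Site d × Site d × Site d → ℝ≥0∞) :
    ∑' q, F q = ∑' ab : Site d × Site d, ∑' cd : Site d × Site d, F (ab.1, ab.2, cd.1, cd.2) := by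
  rw [← (Equiv.prodAssoc (Site d) (Site d) (Site d × Site d)).tsum_eq F, ENNReal.tsum_prod']
  rfl

/-! ### `Ψ^{(0)}` and the passage from `Π^{(N)}` to `Ψ^{(N)}` ((7.5.7)–(7.5.8), (7.5.10)) -/

/-- **(7.5.10)**: `Σ_{w,u} Ψ^{(0)}(w, u) = Σ_{w,u} τ(w) τ(u) τ(w - u) = Δ_{p_c}(0)`.
[cite: HeydenreichVanDerHofstad2017, (7.5.10)] -/
theorem tsum_percPsi_zero : ∑' p : Site d × Site d, percPsi d 0 p.1 p.2 = percTri d 0 := by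
  calc ∑' p : Site d × Site d, percPsi d 0 p.1 p.2
      = ∑' p : Site d × Site d, tauPcE d p.2 * tauPcE d (p.1 - p.2) * tauPcE d (0 - p.1) := by
        refine tsum_congr fun p => ?_
        show percA3 d 0 p.2 p.1 = _
        rw [percA3_eq, sub_zero, sub_zero, zero_sub, tauPcE_neg]
        ring
    _ = ∑' p : Site d × Site d, tauPcE d p.1 * tauPcE d (p.2 - p.1) * tauPcE d (0 - p.2) :=
        (Equiv.prodComm (Site d) (Site d)).tsum_eq
          (fun p : Site d × Site d => tauPcE d p.1 * tauPcE d (p.2 - p.1) * tauPcE d (0 - p.2))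
    _ = percTri d 0 := rfl

/-- `Σ_{w,u} Ψ^{(0)}(w, u) ≤ Δ_{p_c}`. [cite: HeydenreichVanDerHofstad2017, (7.5.10)] -/
theorem tsum_percPsi_zero_le : ∑' p : Site d × Site d, percPsi d 0 p.1 p.2 ≤ percTriBar d :=
  tsum_percPsi_zero.trans_le (le_iSup (percTri d) 0)

/-- **(7.5.7)**: `Σ_x A₃(z, t, x) = Σ_x B₂⁽¹⁾(z, t, x, x) ≤ Σ_{w,u} B₂(z, t, w, u)`.
[cite: HeydenreichVanDerHofstad2017, (7.5.7)] -/
theorem tsum_percA3_le_tsum_percB2 (z t : Site d) :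
    ∑' x : Site d, percA3 d z t x ≤ ∑' p : Site d × Site d, percB2 d z t p.1 p.2 := by
  calc ∑' x : Site d, percA3 d z t x = ∑' x : Site d, percB2one d z t x x := by
        refine tsum_congr fun x => ?_
        rw [percA3_eq, percB2one, sub_self, tauPcE_zero, mul_one]
        ring
    _ ≤ ∑' x : Site d, percB2 d z t x x :=
        ENNReal.tsum_le_tsum fun x => by rw [percB2_eq]; exact le_self_add
    _ ≤ ∑' p : Site d × Site d, percB2 d z t p.1 p.2 :=
        ENNReal.tsum_comp_le_tsum_of_injective (f := fun x : Site d => (x, x))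
          (fun x y h => congrArg Prod.fst h) (fun p : Site d × Site d => percB2 d z t p.1 p.2)

/-- **(7.5.8)** for the diagrams: `Σ_x [diagram of Π^{(N+1)}](x) ≤ Σ_{w,u} Ψ^{(N+1)}(w, u)`.
[cite: HeydenreichVanDerHofstad2017, (7.5.8)] -/
theorem tsum_piNDiagramPc_succ_le_tsum_percPsi (n : ℕ) :
    ∑' x : Site d, piNDiagramPc d (n + 1) x ≤ ∑' p : Site d × Site d, percPsi d (n + 1) p.1 p.2 := by
  calc ∑' x : Site d, piNDiagramPc d (n + 1) x
      = ∑' x : Site d, ∑' q : Site d × Site d × Site d × Site d,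
          percPsi d n q.1 q.2.1 * percB1 d q.1 q.2.1 q.2.2.1 q.2.2.2 * percA3 d q.2.2.1 q.2.2.2 x := rfl
    _ = ∑' q : Site d × Site d × Site d × Site d, percPsi d n q.1 q.2.1 *
          percB1 d q.1 q.2.1 q.2.2.1 q.2.2.2 * ∑' x : Site d, percA3 d q.2.2.1 q.2.2.2 x := by
        rw [ENNReal.tsum_comm]
        exact tsum_congr fun q => ENNReal.tsum_mul_left
    _ ≤ ∑' q : Site d × Site d × Site d × Site d, percPsi d n q.1 q.2.1 *
          percB1 d q.1 q.2.1 q.2.2.1 q.2.2.2 * ∑' p : Site d × Site d, percB2 d q.2.2.1 q.2.2.2 p.1 p.2 :=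
        ENNReal.tsum_le_tsum fun q => mul_le_mul' le_rfl (tsum_percA3_le_tsum_percB2 _ _)
    _ = ∑' q : Site d × Site d × Site d × Site d, ∑' p : Site d × Site d, percPsi d n q.1 q.2.1 *
          percB1 d q.1 q.2.1 q.2.2.1 q.2.2.2 * percB2 d q.2.2.1 q.2.2.2 p.1 p.2 :=
        tsum_congr fun q => ENNReal.tsum_mul_left.symm
    _ = ∑' p : Site d × Site d, ∑' q : Site d × Site d × Site d × Site d, percPsi d n q.1 q.2.1 *
          percB1 d q.1 q.2.1 q.2.2.1 q.2.2.2 * percB2 d q.2.2.1 q.2.2.2 p.1 p.2 := ENNReal.tsum_comm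
    _ = ∑' p : Site d × Site d, percPsi d (n + 1) p.1 p.2 := rfl

/-! ### The recursion step (7.5.11) -/

/-- `Σ_{z,t,w',u'} B₁(w, u, z, t) B₂(z, t, w', u')` for fixed `(w, u)` (indexed by
`(z, t, w', u') ∈ ℤ^d × ℤ^d × ℤ^d × ℤ^d`). [cite: HeydenreichVanDerHofstad2017, (7.5.11)–(7.5.12)] -/
def percB1B2Sum (d : ℕ) (w u : Site d) : ℝ≥0∞ :=
  ∑' q : Site d × Site d × Site d × Site d, percB1 d w u q.1 q.2.1 * percB2 d q.1 q.2.1 q.2.2.1 q.2.2.2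

/-- `max_{w,u} Σ_{z,t,w',u'} B₁(w, u, z, t) B₂(z, t, w', u')` (the supremum, in `[0, ∞]`).
[cite: HeydenreichVanDerHofstad2017, (7.5.12)] -/
def percB1B2Norm (d : ℕ) : ℝ≥0∞ := ⨆ p : Site d × Site d, percB1B2Sum d p.1 p.2

/-- `Σ_{z,t,w',u'} B₁ B₂ = Σ_{z,t} B₁(w,u,z,t) Σ_{w',u'} B₂(z,t,w',u')`. [folklore] -/
theorem percB1B2Sum_eq (w u : Site d) : percB1B2Sum d w u =
    ∑' zt : Site d × Site d, percB1 d w u zt.1 zt.2 * ∑' p : Site d × Site d, percB2 d zt.1 zt.2 p.1 p.2 := by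
  rw [percB1B2Sum, tsum_quad_eq_tsum_pair_pair]
  refine tsum_congr fun zt => ?_
  dsimp only
  exact ENNReal.tsum_mul_left

/-- **(7.5.11)**: `Σ_{w,u} Ψ^{(N+1)}(w, u) ≤ (Σ_{w,u} Ψ^{(N)}(w, u)) · max_{w,u} Σ_{z,t,w',u'} B₁ B₂`.
[cite: HeydenreichVanDerHofstad2017, (7.5.11)] -/
theorem tsum_percPsi_succ_le (n : ℕ) :
    ∑' p : Site d × Site d, percPsi d (n + 1) p.1 p.2 ≤
      (∑' p : Site d × Site d, percPsi d n p.1 p.2) * percB1B2Norm d := by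
  calc ∑' p : Site d × Site d, percPsi d (n + 1) p.1 p.2
      = ∑' p : Site d × Site d, ∑' q : Site d × Site d × Site d × Site d, percPsi d n q.1 q.2.1 *
          percB1 d q.1 q.2.1 q.2.2.1 q.2.2.2 * percB2 d q.2.2.1 q.2.2.2 p.1 p.2 := rfl
    _ = ∑' q : Site d × Site d × Site d × Site d, percPsi d n q.1 q.2.1 *
          percB1 d q.1 q.2.1 q.2.2.1 q.2.2.2 * ∑' p : Site d × Site d, percB2 d q.2.2.1 q.2.2.2 p.1 p.2 := by
        rw [ENNReal.tsum_comm]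
        exact tsum_congr fun q => ENNReal.tsum_mul_left
    _ = ∑' wu : Site d × Site d, ∑' zt : Site d × Site d, percPsi d n wu.1 wu.2 *
          (percB1 d wu.1 wu.2 zt.1 zt.2 * ∑' p : Site d × Site d, percB2 d zt.1 zt.2 p.1 p.2) := by
        rw [tsum_quad_eq_tsum_pair_pair]
        exact tsum_congr fun wu => tsum_congr fun zt => mul_assoc _ _ _
    _ = ∑' wu : Site d × Site d, percPsi d n wu.1 wu.2 * percB1B2Sum d wu.1 wu.2 := by
        refine tsum_congr fun wu => ?_
        rw [ENNReal.tsum_mul_left, percB1B2Sum_eq]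
    _ ≤ ∑' wu : Site d × Site d, percPsi d n wu.1 wu.2 * percB1B2Norm d :=
        ENNReal.tsum_le_tsum fun wu =>
          mul_le_mul' le_rfl (le_iSup (fun p : Site d × Site d => percB1B2Sum d p.1 p.2) wu)
    _ = (∑' p : Site d × Site d, percPsi d n p.1 p.2) * percB1B2Norm d := ENNReal.tsum_mul_right

/-- `Σ_{w,u} Ψ^{(N)}(w, u) ≤ Δ_{p_c} · (max Σ B₁B₂)^N`. [cite: HeydenreichVanDerHofstad2017, (7.5.9)–(7.5.11)] -/
theorem tsum_percPsi_le_mul_pow (n : ℕ) :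
    ∑' p : Site d × Site d, percPsi d n p.1 p.2 ≤ percTriBar d * percB1B2Norm d ^ n := by
  induction n with
  | zero => simpa using tsum_percPsi_zero_le
  | succ n ih =>
    calc ∑' p : Site d × Site d, percPsi d (n + 1) p.1 p.2
        ≤ (∑' p : Site d × Site d, percPsi d n p.1 p.2) * percB1B2Norm d := tsum_percPsi_succ_le n
      _ ≤ percTriBar d * percB1B2Norm d ^ n * percB1B2Norm d := mul_le_mul' ih le_rfl
      _ = percTriBar d * percB1B2Norm d ^ (n + 1) := by rw [pow_succ, mul_assoc]


/-! ### The bound (7.5.12) on the kernel: `max Σ B₁B₂ ≤ 2 Δ̃_{p_c} Δ_{p_c}` -/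

/-- Shift of the summation variable: `Σ_a G(a) = Σ_a G(a + c)`. [folklore] -/
theorem tsum_shift (G : Site d → ℝ≥0∞) (c : Site d) : ∑' a, G a = ∑' a, G (a + c) :=
  ((Equiv.addRight c).tsum_eq G).symm

/-- `A (Σ_t B t) Y = Σ_t A (B t) Y`. [folklore] -/
theorem mul_tsum_mul {ι : Type*} (A Y : ℝ≥0∞) (B : ι → ℝ≥0∞) :
    A * (∑' t, B t) * Y = ∑' t, A * B t * Y := by
  rw [ENNReal.tsum_mul_right, ENNReal.tsum_mul_left]

/-- **Two lines in series between fixed endpoints**: `Σ_y f(y - a) g(b - y) = Σ_y f(y) g((b - a) - y)`.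
[folklore] -/
theorem tsum_series2 (f g : Site d → ℝ≥0∞) (a b : Site d) :
    ∑' y : Site d, f (y - a) * g (b - y) = ∑' y : Site d, f y * g (b - a - y) := by
  rw [← Equiv.tsum_eq (Equiv.addRight a)]
  refine tsum_congr fun y => ?_
  simp only [Equiv.coe_addRight]
  rw [add_sub_cancel_right, show b - (y + a) = b - a - y by abel]

/-- The **open bubble** `(τ ⋆ τ)(x) = Σ_y τ(y) τ(x - y)` at `p = p_c`, in `[0, ∞]`. [folklore] -/
def percBubble (d : ℕ) (x : Site d) : ℝ≥0∞ := ∑' y : Site d, tauPcE d y * tauPcE d (x - y)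

/-- `Σ_y τ(y - a) τ(b - y) = (τ ⋆ τ)(b - a)`. [folklore] -/
theorem tsum_tau2_eq_percBubble (a b : Site d) :
    ∑' y : Site d, tauPcE d (y - a) * tauPcE d (b - y) = percBubble d (b - a) :=
  tsum_series2 _ _ a b

/-- `Δ_{p_c}(0) = Σ_{y,z} τ(y) τ(z - y) τ(z)`. [cite: HeydenreichVanDerHofstad2017, (7.2.1)] -/
theorem percTri_zero_eq :
    percTri d 0 = ∑' yz : Site d × Site d, tauPcE d yz.1 * tauPcE d (yz.2 - yz.1) * tauPcE d yz.2 := by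
  refine tsum_congr fun yz => ?_
  rw [zero_sub, tauPcE_neg]

/-- Closing a bubble by a line through the origin gives the triangle at `0`:
`Σ_a τ(-a) (τ ⋆ τ)(-a) = Δ_{p_c}(0)`. [folklore] -/
theorem tsum_tau_mul_percBubble_neg :
    ∑' a : Site d, tauPcE d (-a) * percBubble d (-a) = percTri d 0 := by
  calc ∑' a : Site d, tauPcE d (-a) * percBubble d (-a)
      = ∑' a : Site d, tauPcE d a * percBubble d a :=
        (Equiv.neg (Site d)).tsum_eq (fun a => tauPcE d a * percBubble d a)
    _ = ∑' a : Site d, ∑' y : Site d, tauPcE d y * tauPcE d (a - y) * tauPcE d a := by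
        refine tsum_congr fun a => ?_
        rw [percBubble, mul_comm, ← ENNReal.tsum_mul_right]
    _ = ∑' y : Site d, ∑' a : Site d, tauPcE d y * tauPcE d (a - y) * tauPcE d a := ENNReal.tsum_comm
    _ = ∑' yz : Site d × Site d, tauPcE d yz.1 * tauPcE d (yz.2 - yz.1) * tauPcE d yz.2 :=
        (ENNReal.tsum_prod (f := fun y a => tauPcE d y * tauPcE d (a - y) * tauPcE d a)).symm
    _ = percTri d 0 := percTri_zero_eq.symm

/-- **(7.5.13)**, the `B₂⁽¹⁾` term: `Σ_{z,t,w',u'} B₁(w,u,z,t) B₂⁽¹⁾(z,t,w',u')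
= Σ_{z,t} τ̃(t-u) τ(z-w) τ(t-z) Δ_{p_c}(z-t) ≤ Δ̃_{p_c}(u-w) Δ_{p_c} ≤ Δ̃_{p_c} Δ_{p_c}`.
[cite: HeydenreichVanDerHofstad2017, (7.5.13)] -/
theorem tsum_percB1_mul_percB2one_le (w u : Site d) :
    ∑' q : Site d × Site d × Site d × Site d,
        percB1 d w u q.1 q.2.1 * percB2one d q.1 q.2.1 q.2.2.1 q.2.2.2 ≤
      percTriTildeBar d * percTriBar d := by
  calc ∑' q : Site d × Site d × Site d × Site d,
        percB1 d w u q.1 q.2.1 * percB2one d q.1 q.2.1 q.2.2.1 q.2.2.2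
      = ∑' zt : Site d × Site d, ∑' p : Site d × Site d,
          percB1 d w u zt.1 zt.2 * percB2one d zt.1 zt.2 p.1 p.2 := by
        rw [tsum_quad_eq_tsum_pair_pair]
    _ = ∑' zt : Site d × Site d, percB1 d w u zt.1 zt.2 * tauPcE d (zt.2 - zt.1) *
          ∑' p : Site d × Site d,
            tauPcE d (p.1 - zt.2) * tauPcE d (p.2 - p.1) * tauPcE d (zt.1 - p.2) := by
        refine tsum_congr fun zt => ?_
        rw [← ENNReal.tsum_mul_left]
        refine tsum_congr fun p => ?_
        rw [percB2one, tauPcE_sub_comm p.2 zt.1]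
        ring
    _ = ∑' zt : Site d × Site d, percB1 d w u zt.1 zt.2 * tauPcE d (zt.2 - zt.1) *
          percTri d (zt.1 - zt.2) := by
        refine tsum_congr fun zt => ?_
        rw [tsum_tau3_eq_percTri]
    _ ≤ ∑' zt : Site d × Site d, percB1 d w u zt.1 zt.2 * tauPcE d (zt.2 - zt.1) * percTriBar d :=
        ENNReal.tsum_le_tsum fun zt => mul_le_mul' le_rfl (le_iSup (percTri d) _)
    _ = (∑' zt : Site d × Site d,
          tauPcE d (zt.1 - w) * tauPcE d (zt.2 - zt.1) * tauTildePcE d (u - zt.2)) * percTriBar d := by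
        rw [ENNReal.tsum_mul_right]
        congr 1
        refine tsum_congr fun zt => ?_
        rw [percB1_eq, tauTildePcE_sub_comm zt.2 u]
        ring
    _ = percTriTilde d (u - w) * percTriBar d := by rw [tsum_tau2tilde_eq_percTriTilde]
    _ ≤ percTriTildeBar d * percTriBar d := mul_le_mul' (le_iSup (percTriTilde d) _) le_rfl

/-- **(7.5.14)**, the `B₂⁽²⁾` term: `Σ_{z,t,w',u',a} τ̃(t-u) τ(z-w) δ_{t,w'} τ(t-a) τ(u'-z) τ(z-a)
τ(u'-a) ≤ Δ̃_{p_c} Δ_{p_c}` ("making use of translation invariance": `a' = a - z`, `u'' = u' - z`).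
[cite: HeydenreichVanDerHofstad2017, (7.5.14)] -/
theorem tsum_percB1_mul_percB2two_le (w u : Site d) :
    ∑' q : Site d × Site d × Site d × Site d,
        percB1 d w u q.1 q.2.1 * percB2two d q.1 q.2.1 q.2.2.1 q.2.2.2 ≤
      percTriTildeBar d * percTriBar d := by
  calc ∑' q : Site d × Site d × Site d × Site d,
        percB1 d w u q.1 q.2.1 * percB2two d q.1 q.2.1 q.2.2.1 q.2.2.2
      = ∑' z : Site d, ∑' t : Site d, ∑' w' : Site d, ∑' u' : Site d,
          percB1 d w u z t * percB2two d z t w' u' := by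
        rw [ENNReal.tsum_prod']
        refine tsum_congr fun z => ?_
        rw [ENNReal.tsum_prod']
        refine tsum_congr fun t => ?_
        exact ENNReal.tsum_prod'
    -- the Kronecker delta `δ_{t,w'}`
    _ = ∑' z : Site d, ∑' t : Site d, ∑' u' : Site d, percB1 d w u z t * ∑' a : Site d,
          tauPcE d (a - t) * tauPcE d (z - a) * tauPcE d (u' - a) * tauPcE d (u' - z) := by
        refine tsum_congr fun z => tsum_congr fun t => ?_
        rw [tsum_eq_single t]
        · simp [percB2two]
        · intro w' hw'
          simp [percB2two, Ne.symm hw']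
    _ = ∑' z : Site d, ∑' t : Site d, ∑' u' : Site d, ∑' a : Site d,
          tauPcE d (z - w) * tauPcE d (z - a) * (tauTildePcE d (t - u) * tauPcE d (a - t)) *
            (tauPcE d (u' - a) * tauPcE d (z - u')) := by
        refine tsum_congr fun z => tsum_congr fun t => tsum_congr fun u' => ?_
        rw [← ENNReal.tsum_mul_left]
        refine tsum_congr fun a => ?_
        rw [percB1_eq, tauPcE_sub_comm u' z]
        ring
    -- for fixed `z`: reorder to `Σ_a Σ_t Σ_{u'}` and factor
    _ = ∑' z : Site d, ∑' a : Site d, tauPcE d (z - w) * tauPcE d (z - a) *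
          (∑' t : Site d, tauTildePcE d (t - u) * tauPcE d (a - t)) *
          (∑' u' : Site d, tauPcE d (u' - a) * tauPcE d (z - u')) := by
        refine tsum_congr fun z => ?_
        calc ∑' t : Site d, ∑' u' : Site d, ∑' a : Site d,
              tauPcE d (z - w) * tauPcE d (z - a) * (tauTildePcE d (t - u) * tauPcE d (a - t)) *
                (tauPcE d (u' - a) * tauPcE d (z - u'))
            = ∑' t : Site d, ∑' a : Site d, ∑' u' : Site d,
              tauPcE d (z - w) * tauPcE d (z - a) * (tauTildePcE d (t - u) * tauPcE d (a - t)) *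
                (tauPcE d (u' - a) * tauPcE d (z - u')) := tsum_congr fun t => ENNReal.tsum_comm
          _ = ∑' a : Site d, ∑' t : Site d, ∑' u' : Site d,
              tauPcE d (z - w) * tauPcE d (z - a) * (tauTildePcE d (t - u) * tauPcE d (a - t)) *
                (tauPcE d (u' - a) * tauPcE d (z - u')) := ENNReal.tsum_comm
          _ = _ := by
              refine tsum_congr fun a => ?_
              simp_rw [ENNReal.tsum_mul_left]
              rw [ENNReal.tsum_mul_right, ENNReal.tsum_mul_left]
    -- the `u'`-sum is an open bubble
    _ = ∑' z : Site d, ∑' a : Site d, tauPcE d (z - w) * tauPcE d (z - a) *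
          (∑' t : Site d, tauTildePcE d (t - u) * tauPcE d (a - t)) * percBubble d (z - a) := by
        refine tsum_congr fun z => tsum_congr fun a => ?_
        rw [tsum_tau2_eq_percBubble]
    -- translation `a = a' + z`
    _ = ∑' z : Site d, ∑' a : Site d, tauPcE d (z - w) * tauPcE d (-a) *
          (∑' t : Site d, tauTildePcE d (t - u) * tauPcE d (a + z - t)) * percBubble d (-a) := by
        refine tsum_congr fun z => ?_
        rw [tsum_shift _ z]
        refine tsum_congr fun a => ?_
        rw [show z - (a + z) = -a by abel]
    _ = ∑' z : Site d, ∑' a : Site d, ∑' t : Site d, tauPcE d (z - w) * tauPcE d (-a) *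
          (tauTildePcE d (t - u) * tauPcE d (a + z - t)) * percBubble d (-a) := by
        refine tsum_congr fun z => tsum_congr fun a => ?_
        rw [mul_tsum_mul]
    -- reorder to `Σ_a Σ_z Σ_t`, factor `τ(-a) (τ ⋆ τ)(-a)`, translation `t = t' + a`
    _ = ∑' a : Site d, tauPcE d (-a) * percBubble d (-a) * ∑' z : Site d, ∑' t : Site d,
          tauPcE d (z - w) * tauPcE d (t - z) * tauTildePcE d (u - a - t) := by
        rw [ENNReal.tsum_comm]
        refine tsum_congr fun a => ?_
        rw [← ENNReal.tsum_mul_left]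
        refine tsum_congr fun z => ?_
        conv_lhs => rw [tsum_shift _ a]
        rw [← ENNReal.tsum_mul_left]
        refine tsum_congr fun t => ?_
        rw [show a + z - (t + a) = z - t by abel, tauPcE_sub_comm z t,
          show t + a - u = -(u - a - t) by abel, tauTildePcE_neg]
        ring
    _ = ∑' a : Site d, tauPcE d (-a) * percBubble d (-a) * percTriTilde d (u - a - w) := by
        refine tsum_congr fun a => ?_
        rw [← ENNReal.tsum_prod, tsum_tau2tilde_eq_percTriTilde]
    _ ≤ ∑' a : Site d, tauPcE d (-a) * percBubble d (-a) * percTriTildeBar d :=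
        ENNReal.tsum_le_tsum fun a => mul_le_mul' le_rfl (le_iSup (percTriTilde d) _)
    _ = percTri d 0 * percTriTildeBar d := by
        rw [ENNReal.tsum_mul_right, tsum_tau_mul_percBubble_neg]
    _ ≤ percTriBar d * percTriTildeBar d := mul_le_mul' (le_iSup (percTri d) 0) le_rfl
    _ = percTriTildeBar d * percTriBar d := mul_comm _ _

/-- **(7.5.12)**: `Σ_{z,t,w',u'} B₁(w,u,z,t) B₂(z,t,w',u') ≤ 2 Δ̃_{p_c} Δ_{p_c}` for every `(w, u)`.
[cite: HeydenreichVanDerHofstad2017, (7.5.12)–(7.5.14)] -/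
theorem percB1B2Sum_le (w u : Site d) :
    percB1B2Sum d w u ≤ 2 * percTriTildeBar d * percTriBar d := by
  have hsplit : percB1B2Sum d w u =
      (∑' q : Site d × Site d × Site d × Site d,
        percB1 d w u q.1 q.2.1 * percB2one d q.1 q.2.1 q.2.2.1 q.2.2.2) +
      ∑' q : Site d × Site d × Site d × Site d,
        percB1 d w u q.1 q.2.1 * percB2two d q.1 q.2.1 q.2.2.1 q.2.2.2 := by
    rw [percB1B2Sum, ← ENNReal.tsum_add]
    exact tsum_congr fun q => by rw [percB2_eq, mul_add]
  rw [hsplit, two_mul, add_mul]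
  exact add_le_add (tsum_percB1_mul_percB2one_le w u) (tsum_percB1_mul_percB2two_le w u)

/-- **(7.5.12)**: `max_{w,u} Σ_{z,t,w',u'} B₁(w,u,z,t) B₂(z,t,w',u') ≤ 2 Δ̃_{p_c} Δ_{p_c}`.
[cite: HeydenreichVanDerHofstad2017, (7.5.12)] -/
theorem percB1B2Norm_le : percB1B2Norm d ≤ 2 * percTriTildeBar d * percTriBar d :=
  iSup_le fun p => percB1B2Sum_le p.1 p.2

/-! ### (7.5.9) and Proposition 7.4 (7.5.3) for the diagrams at `p_c` -/

/-- **(7.5.9)**: `Σ_{w,u} Ψ^{(N)}(w, u) ≤ Δ_{p_c} (2 Δ̃_{p_c} Δ_{p_c})^N` (all `N ≥ 0`; at `p = p_c`,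
for the explicit lattice sums `percPsi`, in `[0, ∞]`, no hypothesis on `d`).
[cite: HeydenreichVanDerHofstad2017, (7.5.9)–(7.5.14)] -/
theorem tsum_percPsi_le (n : ℕ) :
    ∑' p : Site d × Site d, percPsi d n p.1 p.2 ≤
      percTriBar d * (2 * percTriTildeBar d * percTriBar d) ^ n :=
  (tsum_percPsi_le_mul_pow n).trans (mul_le_mul' le_rfl (pow_le_pow_left' percB1B2Norm_le n))

/-- **Heydenreich–van der Hofstad, Proposition 7.4, (7.5.3), for the diagrams at `p_c`**:
`Σ_x [diagram (7.4.10) bounding Π^{(N)}_{p_c}](x) ≤ Δ_{p_c} (2 Δ̃_{p_c} Δ_{p_c})^N` for all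
`N ≥ 1` — "implying that `Π̂^{(N)}_p(0)` is exponentially small in `N` whenever these triangles are
small" ("we need that `2Δ̃_pΔ_p < 1` in order for the geometric sum (over `N`) to converge"). Here
`Δ_{p_c}, Δ̃_{p_c}` are the suprema `percTriBar d, percTriTildeBar d` and everything is in `[0, ∞]`
(no hypothesis on `d`; the bound is an identity-and-monotonicity computation on non-negative
lattice sums). [cite: HeydenreichVanDerHofstad2017, Prop. 7.4 ((7.5.3)) and (7.5.5)–(7.5.14)] -/
theorem HvdH2017_prop74_piNDiagramPc_le (N : ℕ) (hN : 1 ≤ N) :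
    ∑' x : Site d, piNDiagramPc d N x ≤ percTriBar d * (2 * percTriTildeBar d * percTriBar d) ^ N := by
  obtain ⟨n, rfl⟩ : ∃ n, N = n + 1 := ⟨N - 1, by omega⟩
  exact (tsum_piNDiagramPc_succ_le_tsum_percPsi n).trans (tsum_percPsi_le (n + 1))

/-- **The geometric sum over `N ≥ 1`**: `Σ_{N ≥ 1} Σ_x [diagram of Π^{(N)}](x)
≤ Δ_{p_c} · 2Δ̃_{p_c}Δ_{p_c} · (1 - 2Δ̃_{p_c}Δ_{p_c})⁻¹` (in `[0, ∞]`, truncated subtraction).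
[cite: HeydenreichVanDerHofstad2017, Prop. 7.4 ((7.5.3)) and §7.5 (the geometric sum over N)] -/
theorem tsum_tsum_piNDiagramPc_succ_le :
    ∑' n : ℕ, ∑' x : Site d, piNDiagramPc d (n + 1) x ≤
      percTriBar d * (2 * percTriTildeBar d * percTriBar d) *
        (1 - 2 * percTriTildeBar d * percTriBar d)⁻¹ := by
  set ρ : ℝ≥0∞ := 2 * percTriTildeBar d * percTriBar d with hρ
  calc ∑' n : ℕ, ∑' x : Site d, piNDiagramPc d (n + 1) x
      ≤ ∑' n : ℕ, percTriBar d * ρ ^ (n + 1) :=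
        ENNReal.tsum_le_tsum fun n => HvdH2017_prop74_piNDiagramPc_le (n + 1) (by omega)
    _ = ∑' n : ℕ, percTriBar d * ρ * ρ ^ n := tsum_congr fun n => by rw [pow_succ]; ring
    _ = percTriBar d * ρ * ∑' n : ℕ, ρ ^ n := ENNReal.tsum_mul_left
    _ = percTriBar d * ρ * (1 - ρ)⁻¹ := by rw [ENNReal.tsum_geometric]

/-- **Exponential smallness in `N` gives summability over `(N, x)`, `N ≥ 1`**: if `Δ_{p_c} < ∞` and
`2 Δ̃_{p_c} Δ_{p_c} < 1` then `Σ_{N ≥ 1} Σ_x [diagram of Π^{(N)}](x) < ∞`.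
[cite: HeydenreichVanDerHofstad2017, Prop. 7.4 ((7.5.3)) and §7.5 (the geometric sum over N)] -/
theorem tsum_tsum_piNDiagramPc_succ_lt_top (hΔ : percTriBar d < ⊤)
    (hρ : 2 * percTriTildeBar d * percTriBar d < 1) :
    ∑' n : ℕ, ∑' x : Site d, piNDiagramPc d (n + 1) x < ⊤ := by
  refine lt_of_le_of_lt tsum_tsum_piNDiagramPc_succ_le ?_
  refine ENNReal.mul_lt_top (ENNReal.mul_lt_top hΔ (lt_trans hρ ENNReal.one_lt_top)) ?_
  exact ENNReal.inv_lt_top.2 (tsub_pos_iff_lt.2 hρ)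

/-! ### The reversed recursion `Ψ̄` ((7.5.20)) and Exercise 7.5 -/

/-- **The reversed recursion** `Ψ̄^{(0)} := Ψ^{(0)}`,
`Ψ̄^{(i)}(x, y) := Σ_{s,t,u,v} B₂(x, y, s, t) B₁(s, t, u, v) Ψ̄^{(i-1)}(u, v)` ("a small variant of
`Ψ^{(N-i)}`", used to close the diagrams from the right when a weight sits in the middle; the
quadruple sum is indexed by `(s, t, u, v) ∈ ℤ^d × ℤ^d × ℤ^d × ℤ^d`; at `p = p_c`, in `[0, ∞]`).
[cite: HeydenreichVanDerHofstad2017, (7.5.20)] -/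
def percPsiBar (d : ℕ) : ℕ → Site d → Site d → ℝ≥0∞
  | 0, x, y => percPsi d 0 x y
  | i + 1, x, y => ∑' q : Site d × Site d × Site d × Site d,
      percB2 d x y q.1 q.2.1 * percB1 d q.1 q.2.1 q.2.2.1 q.2.2.2 * percPsiBar d i q.2.2.1 q.2.2.2

/-- `Σ_{x,y,s,t} B₂(x, y, s, t) B₁(s, t, u, v)` for fixed `(u, v)` (indexed by
`(x, y, s, t) ∈ ℤ^d × ℤ^d × ℤ^d × ℤ^d`): the kernel of the reversed recursion summed over its left
variables. [cite: HeydenreichVanDerHofstad2017, (7.5.20) and Exercise 7.5] -/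
def percB2B1Sum (d : ℕ) (u v : Site d) : ℝ≥0∞ :=
  ∑' q : Site d × Site d × Site d × Site d,
    percB2 d q.1 q.2.1 q.2.2.1 q.2.2.2 * percB1 d q.2.2.1 q.2.2.2 u v

/-- `max_{u,v} Σ_{x,y,s,t} B₂(x, y, s, t) B₁(s, t, u, v)` (the supremum, in `[0, ∞]`).
[cite: HeydenreichVanDerHofstad2017, (7.5.20) and Exercise 7.5] -/
def percB2B1Norm (d : ℕ) : ℝ≥0∞ := ⨆ p : Site d × Site d, percB2B1Sum d p.1 p.2

/-- `Σ_{x,y,s,t} B₂ B₁ = Σ_{s,t} (Σ_{x,y} B₂(x,y,s,t)) B₁(s,t,u,v)`. [folklore] -/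
theorem percB2B1Sum_eq (u v : Site d) : percB2B1Sum d u v =
    ∑' st : Site d × Site d, (∑' p : Site d × Site d, percB2 d p.1 p.2 st.1 st.2) *
      percB1 d st.1 st.2 u v := by
  rw [percB2B1Sum, tsum_quad_eq_tsum_pair_pair, ENNReal.tsum_comm]
  refine tsum_congr fun st => ?_
  dsimp only
  exact ENNReal.tsum_mul_right

/-- The recursion step for `Ψ̄`: `Σ_{x,y} Ψ̄^{(i+1)}(x, y) ≤ (Σ_{u,v} Ψ̄^{(i)}(u, v)) ·
max_{u,v} Σ_{x,y,s,t} B₂ B₁`. [cite: HeydenreichVanDerHofstad2017, Exercise 7.5] -/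
theorem tsum_percPsiBar_succ_le (i : ℕ) :
    ∑' p : Site d × Site d, percPsiBar d (i + 1) p.1 p.2 ≤
      (∑' p : Site d × Site d, percPsiBar d i p.1 p.2) * percB2B1Norm d := by
  calc ∑' p : Site d × Site d, percPsiBar d (i + 1) p.1 p.2
      = ∑' p : Site d × Site d, ∑' q : Site d × Site d × Site d × Site d,
          percB2 d p.1 p.2 q.1 q.2.1 * percB1 d q.1 q.2.1 q.2.2.1 q.2.2.2 *
            percPsiBar d i q.2.2.1 q.2.2.2 := rfl
    _ = ∑' q : Site d × Site d × Site d × Site d, (∑' p : Site d × Site d,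
          percB2 d p.1 p.2 q.1 q.2.1) * percB1 d q.1 q.2.1 q.2.2.1 q.2.2.2 *
            percPsiBar d i q.2.2.1 q.2.2.2 := by
        rw [ENNReal.tsum_comm]
        refine tsum_congr fun q => ?_
        rw [ENNReal.tsum_mul_right, ENNReal.tsum_mul_right]
    _ = ∑' st : Site d × Site d, ∑' uv : Site d × Site d, (∑' p : Site d × Site d,
          percB2 d p.1 p.2 st.1 st.2) * percB1 d st.1 st.2 uv.1 uv.2 * percPsiBar d i uv.1 uv.2 := by
        rw [tsum_quad_eq_tsum_pair_pair]
    _ = ∑' uv : Site d × Site d, ∑' st : Site d × Site d, (∑' p : Site d × Site d,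
          percB2 d p.1 p.2 st.1 st.2) * percB1 d st.1 st.2 uv.1 uv.2 * percPsiBar d i uv.1 uv.2 :=
        ENNReal.tsum_comm
    _ = ∑' uv : Site d × Site d, percB2B1Sum d uv.1 uv.2 * percPsiBar d i uv.1 uv.2 := by
        refine tsum_congr fun uv => ?_
        rw [ENNReal.tsum_mul_right, percB2B1Sum_eq]
    _ ≤ ∑' uv : Site d × Site d, percB2B1Norm d * percPsiBar d i uv.1 uv.2 :=
        ENNReal.tsum_le_tsum fun uv =>
          mul_le_mul' (le_iSup (fun p : Site d × Site d => percB2B1Sum d p.1 p.2) uv) le_rfl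
    _ = percB2B1Norm d * ∑' uv : Site d × Site d, percPsiBar d i uv.1 uv.2 := ENNReal.tsum_mul_left
    _ = (∑' p : Site d × Site d, percPsiBar d i p.1 p.2) * percB2B1Norm d := mul_comm _ _

/-- `Σ_a τ(a) (τ ⋆ τ)(a) = Δ_{p_c}(0)`. [folklore] -/
theorem tsum_tau_mul_percBubble :
    ∑' a : Site d, tauPcE d a * percBubble d a = percTri d 0 := by
  rw [← tsum_tau_mul_percBubble_neg]
  exact ((Equiv.neg (Site d)).tsum_eq (fun a => tauPcE d a * percBubble d a)).symm

/-- Reflection-and-shift of the summation variable: `Σ_a G(a) = Σ_b G(c - b)`. [folklore] -/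
theorem tsum_reflect_shift (G : Site d → ℝ≥0∞) (c : Site d) : ∑' a, G a = ∑' b, G (c - b) :=
  ((Equiv.subLeft c).tsum_eq G).symm

/-- The `B₂⁽¹⁾` term of the reversed kernel: `Σ_{x,y,s,t} τ(y-x) τ(t-x) τ(s-y) τ(t-s) τ̃(v-t)
τ(u-s) = Σ_{s,t} Δ_{p_c}(s-t) τ(t-s) τ̃(v-t) τ(u-s) ≤ Δ_{p_c} Δ̃_{p_c}(v-u) ≤ Δ̃_{p_c} Δ_{p_c}`.
[cite: HeydenreichVanDerHofstad2017, Exercise 7.5 (cf. (7.5.13))] -/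
theorem tsum_percB2one_mul_percB1_le (u v : Site d) :
    ∑' q : Site d × Site d × Site d × Site d,
        percB2one d q.1 q.2.1 q.2.2.1 q.2.2.2 * percB1 d q.2.2.1 q.2.2.2 u v ≤
      percTriTildeBar d * percTriBar d := by
  calc ∑' q : Site d × Site d × Site d × Site d,
        percB2one d q.1 q.2.1 q.2.2.1 q.2.2.2 * percB1 d q.2.2.1 q.2.2.2 u v
      = ∑' st : Site d × Site d, ∑' xy : Site d × Site d,
          percB2one d xy.1 xy.2 st.1 st.2 * percB1 d st.1 st.2 u v := by
        rw [tsum_quad_eq_tsum_pair_pair, ENNReal.tsum_comm]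
    _ = ∑' st : Site d × Site d, (∑' xy : Site d × Site d,
          tauPcE d (xy.1 - st.2) * tauPcE d (xy.2 - xy.1) * tauPcE d (st.1 - xy.2)) *
          (tauPcE d (st.2 - st.1) * percB1 d st.1 st.2 u v) := by
        refine tsum_congr fun st => ?_
        rw [← ENNReal.tsum_mul_right]
        refine tsum_congr fun xy => ?_
        rw [percB2one, tauPcE_sub_comm st.2 xy.1]
        ring
    _ = ∑' st : Site d × Site d, percTri d (st.1 - st.2) *
          (tauPcE d (st.2 - st.1) * percB1 d st.1 st.2 u v) := by
        refine tsum_congr fun st => ?_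
        rw [tsum_tau3_eq_percTri]
    _ ≤ ∑' st : Site d × Site d, percTriBar d * (tauPcE d (st.2 - st.1) * percB1 d st.1 st.2 u v) :=
        ENNReal.tsum_le_tsum fun st => mul_le_mul' (le_iSup (percTri d) _) le_rfl
    _ = percTriBar d * ∑' st : Site d × Site d,
          tauPcE d (st.1 - u) * tauPcE d (st.2 - st.1) * tauTildePcE d (v - st.2) := by
        rw [ENNReal.tsum_mul_left]
        congr 1
        refine tsum_congr fun st => ?_
        rw [percB1_eq, tauPcE_sub_comm u st.1]
        ring
    _ = percTriBar d * percTriTilde d (v - u) := by rw [tsum_tau2tilde_eq_percTriTilde]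
    _ ≤ percTriBar d * percTriTildeBar d := mul_le_mul' le_rfl (le_iSup (percTriTilde d) _)
    _ = percTriTildeBar d * percTriBar d := mul_comm _ _

/-- The `B₂⁽²⁾` term of the reversed kernel: `Σ_{x,y,s,t} δ_{y,s} Σ_a τ(a-s) τ(x-a) τ(t-a) τ(t-x)
τ̃(v-t) τ(u-s) ≤ Δ̃_{p_c} Δ_{p_c}` (translation `a = t - b`, then `t = t' + b`).
[cite: HeydenreichVanDerHofstad2017, Exercise 7.5 (cf. (7.5.14))] -/
theorem tsum_percB2two_mul_percB1_le (u v : Site d) :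
    ∑' q : Site d × Site d × Site d × Site d,
        percB2two d q.1 q.2.1 q.2.2.1 q.2.2.2 * percB1 d q.2.2.1 q.2.2.2 u v ≤
      percTriTildeBar d * percTriBar d := by
  calc ∑' q : Site d × Site d × Site d × Site d,
        percB2two d q.1 q.2.1 q.2.2.1 q.2.2.2 * percB1 d q.2.2.1 q.2.2.2 u v
      = ∑' x : Site d, ∑' y : Site d, ∑' s : Site d, ∑' t : Site d,
          percB2two d x y s t * percB1 d s t u v := by
        rw [ENNReal.tsum_prod']
        refine tsum_congr fun x => ?_
        rw [ENNReal.tsum_prod']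
        refine tsum_congr fun y => ?_
        exact ENNReal.tsum_prod'
    -- the Kronecker delta `δ_{y,s}`
    _ = ∑' x : Site d, ∑' s : Site d, ∑' t : Site d, (∑' a : Site d,
          tauPcE d (a - s) * tauPcE d (x - a) * tauPcE d (t - a) * tauPcE d (t - x)) *
            percB1 d s t u v := by
        refine tsum_congr fun x => tsum_congr fun y => ?_
        rw [tsum_eq_single y]
        · simp [percB2two]
        · intro s hs
          simp [percB2two, Ne.symm hs]
    _ = ∑' x : Site d, ∑' s : Site d, ∑' t : Site d, ∑' a : Site d,
          tauPcE d (u - s) * tauPcE d (a - s) * (tauPcE d (t - a) * tauTildePcE d (v - t)) *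
            (tauPcE d (x - a) * tauPcE d (t - x)) := by
        refine tsum_congr fun x => tsum_congr fun s => tsum_congr fun t => ?_
        rw [← ENNReal.tsum_mul_right]
        refine tsum_congr fun a => ?_
        rw [percB1_eq]
        ring
    -- reorder to `Σ_s Σ_t Σ_a Σ_x` and sum the open bubble over `x`
    _ = ∑' s : Site d, ∑' x : Site d, ∑' t : Site d, ∑' a : Site d,
          tauPcE d (u - s) * tauPcE d (a - s) * (tauPcE d (t - a) * tauTildePcE d (v - t)) *
            (tauPcE d (x - a) * tauPcE d (t - x)) := ENNReal.tsum_comm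
    _ = ∑' s : Site d, ∑' t : Site d, ∑' a : Site d, ∑' x : Site d,
          tauPcE d (u - s) * tauPcE d (a - s) * (tauPcE d (t - a) * tauTildePcE d (v - t)) *
            (tauPcE d (x - a) * tauPcE d (t - x)) := by
        refine tsum_congr fun s => ?_
        rw [ENNReal.tsum_comm]
        exact tsum_congr fun t => ENNReal.tsum_comm
    _ = ∑' s : Site d, ∑' t : Site d, ∑' a : Site d,
          tauPcE d (u - s) * tauPcE d (a - s) * (tauPcE d (t - a) * tauTildePcE d (v - t)) *
            percBubble d (t - a) := by
        refine tsum_congr fun s => tsum_congr fun t => tsum_congr fun a => ?_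
        rw [ENNReal.tsum_mul_left, tsum_tau2_eq_percBubble]
    -- reflection `a = t - b`
    _ = ∑' s : Site d, ∑' t : Site d, ∑' b : Site d,
          tauPcE d (u - s) * tauPcE d (t - b - s) * (tauPcE d b * tauTildePcE d (v - t)) *
            percBubble d b := by
        refine tsum_congr fun s => tsum_congr fun t => ?_
        rw [tsum_reflect_shift _ t]
        refine tsum_congr fun b => ?_
        rw [show t - (t - b) = b by abel]
    -- reorder to `Σ_b Σ_s Σ_t`, factor `τ(b) (τ ⋆ τ)(b)`, translation `t = t' + b`
    _ = ∑' s : Site d, ∑' b : Site d, ∑' t : Site d,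
          tauPcE d (u - s) * tauPcE d (t - b - s) * (tauPcE d b * tauTildePcE d (v - t)) *
            percBubble d b := tsum_congr fun s => ENNReal.tsum_comm
    _ = ∑' b : Site d, ∑' s : Site d, ∑' t : Site d,
          tauPcE d (u - s) * tauPcE d (t - b - s) * (tauPcE d b * tauTildePcE d (v - t)) *
            percBubble d b := ENNReal.tsum_comm
    _ = ∑' b : Site d, tauPcE d b * percBubble d b * ∑' s : Site d, ∑' t : Site d,
          tauPcE d (s - u) * tauPcE d (t - s) * tauTildePcE d (v - b - t) := by
        refine tsum_congr fun b => ?_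
        rw [← ENNReal.tsum_mul_left]
        refine tsum_congr fun s => ?_
        conv_lhs => rw [tsum_shift _ b]
        rw [← ENNReal.tsum_mul_left]
        refine tsum_congr fun t => ?_
        rw [show t + b - b - s = t - s by abel, tauPcE_sub_comm u s,
          show v - (t + b) = v - b - t by abel]
        ring
    _ = ∑' b : Site d, tauPcE d b * percBubble d b * percTriTilde d (v - b - u) := by
        refine tsum_congr fun b => ?_
        rw [← ENNReal.tsum_prod, tsum_tau2tilde_eq_percTriTilde]
    _ ≤ ∑' b : Site d, tauPcE d b * percBubble d b * percTriTildeBar d :=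
        ENNReal.tsum_le_tsum fun b => mul_le_mul' le_rfl (le_iSup (percTriTilde d) _)
    _ = percTri d 0 * percTriTildeBar d := by
        rw [ENNReal.tsum_mul_right, tsum_tau_mul_percBubble]
    _ ≤ percTriBar d * percTriTildeBar d := mul_le_mul' (le_iSup (percTri d) 0) le_rfl
    _ = percTriTildeBar d * percTriBar d := mul_comm _ _

/-- The reversed kernel bound: `Σ_{x,y,s,t} B₂(x,y,s,t) B₁(s,t,u,v) ≤ 2 Δ̃_{p_c} Δ_{p_c}` for
every `(u, v)`. [cite: HeydenreichVanDerHofstad2017, Exercise 7.5] -/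
theorem percB2B1Sum_le (u v : Site d) :
    percB2B1Sum d u v ≤ 2 * percTriTildeBar d * percTriBar d := by
  have hsplit : percB2B1Sum d u v =
      (∑' q : Site d × Site d × Site d × Site d,
        percB2one d q.1 q.2.1 q.2.2.1 q.2.2.2 * percB1 d q.2.2.1 q.2.2.2 u v) +
      ∑' q : Site d × Site d × Site d × Site d,
        percB2two d q.1 q.2.1 q.2.2.1 q.2.2.2 * percB1 d q.2.2.1 q.2.2.2 u v := by
    rw [percB2B1Sum, ← ENNReal.tsum_add]
    exact tsum_congr fun q => by rw [percB2_eq, add_mul]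
  rw [hsplit, two_mul, add_mul]
  exact add_le_add (tsum_percB2one_mul_percB1_le u v) (tsum_percB2two_mul_percB1_le u v)

/-- `max_{u,v} Σ_{x,y,s,t} B₂ B₁ ≤ 2 Δ̃_{p_c} Δ_{p_c}`. [cite: HeydenreichVanDerHofstad2017, Exercise 7.5] -/
theorem percB2B1Norm_le : percB2B1Norm d ≤ 2 * percTriTildeBar d * percTriBar d :=
  iSup_le fun p => percB2B1Sum_le p.1 p.2

/-- **Exercise 7.5** ("Prove that `Ψ̄^{(N)}` also obeys (7.5.9)"): `Σ_{x,y} Ψ̄^{(N)}(x, y)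
≤ Δ_{p_c} (2 Δ̃_{p_c} Δ_{p_c})^N` for all `N ≥ 0` (at `p = p_c`, in `[0, ∞]`, no hypothesis on `d`).
[cite: HeydenreichVanDerHofstad2017, Exercise 7.5 and (7.5.9)] -/
theorem tsum_percPsiBar_le (n : ℕ) :
    ∑' p : Site d × Site d, percPsiBar d n p.1 p.2 ≤
      percTriBar d * (2 * percTriTildeBar d * percTriBar d) ^ n := by
  induction n with
  | zero =>
    have h0 : ∀ p : Site d × Site d, percPsiBar d 0 p.1 p.2 = percPsi d 0 p.1 p.2 := fun _ => rfl
    simpa [h0] using (tsum_percPsi_zero_le (d := d))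
  | succ n ih =>
    calc ∑' p : Site d × Site d, percPsiBar d (n + 1) p.1 p.2
        ≤ (∑' p : Site d × Site d, percPsiBar d n p.1 p.2) * percB2B1Norm d :=
          tsum_percPsiBar_succ_le n
      _ ≤ percTriBar d * (2 * percTriTildeBar d * percTriBar d) ^ n *
            (2 * percTriTildeBar d * percTriBar d) := mul_le_mul' ih percB2B1Norm_le
      _ = percTriBar d * (2 * percTriTildeBar d * percTriBar d) ^ (n + 1) := by
          rw [pow_succ, mul_assoc]

end Literature.Barriers.CriticalPhenomena
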